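import Literature.MathematicalPhysics.QuantumLattice.HubbardSpinChargeCertificate
import Literature.MathematicalPhysics.QuantumLattice.OrbitStateLocalCertificate
import Literature.MathematicalPhysics.QuantumLattice.HubbardHalfFilledGroundStateTorus
import HarnessLib

/-!
# Energy-constrained bootstrap certificates in a fixed-`N` sector of a FINITE cluster:
# certified bounds on ground-state expectation values (Wang et al. 2024, §3)

Family `hubbard` (topic `MathematicalPhysics/QuantumLattice`). Wang, Rizzo, … , Navascués,
Acín, *Certifying ground-state properties of many-body systems*, PRX 14 (2024) 031006, §3
eq. (obsopt): to bound the ground-state expectation value of an observable `O` of a FINITE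
system from below one minimises `⟨ψ, O ψ⟩` over the relaxation of the ground-state problem with
the extra polynomial constraint `⟨ψ, (E_up − H) ψ⟩ ≥ 0`, where `E_up ≥ E₀` is a variational
(here: certified) upper bound on the ground-state energy — the ground state is feasible, so every
dual feasible point is a bound. The companion file `HubbardCorrelatorCertificate` proves the
translation-invariant (torus / thermodynamic-limit) form; this file proves the plain SECTOR form
used for fixed-particle-number certificates of a finite graph (bundle
papers/HubbardSuperconductivity/manybody-bootstrap/, certificate format `certsdp/1` §3 mode
`sector` with §7 hypotheses `energy_upper` + multiplier `κ ≥ 0`), i.e. the energy-constrained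
analogue of `groundEnergyAt_ge_of_certificate_charged` (HubbardSpinChargeCertificate):

* `re_dotProduct_ge_of_sector_certificate_ineq`: an identity in the CAR algebra of the cluster
  `X − c·1 − κ (u·1 − H) = Σᵢⱼ Λᵢⱼ Oᵢᴴ Oⱼ + ((Σₖ [H, Xₖ] + Σₗ (Yₗ (N̂ − N) + (N̂ − N) Y'ₗ)) + Σⱼ bⱼ wⱼ)
     + (Σₘ dₘ (Vₘᴴ − Vₘ) + Σₖ aₖ vₖ)`
  (`Λ ⪰ 0`; CHARGED ladder words `wⱼ`, `ladderCharge wⱼ ≠ 0 ∨ ladderSpinCharge wⱼ ≠ 0`; real `dₘ`;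
  ladder words `vₖ`, which are contractions) gives, for EVERY unit `N`-particle vector `ψ` with
  `H ψ = E₀(N) ψ` that is an `S^z`-eigenvector,
  `c − Σₖ ‖aₖ‖ + κ (u − E₀(N)) ≤ Re ⟨ψ, X ψ⟩` — no sign condition on `κ` at this level;
  `…_of_eigenvector`: the same for an eigenvector of `H` with ANY eigenvalue `E` (every stationary
  state satisfies the commutator rows), slack `κ (u − E)`;
* `re_dotProduct_ge_of_sector_certificate_ineq_of_energy_le`: with `0 ≤ κ` and a certified
  `E₀(N) ≤ u` the slack is nonnegative: `c − Σₖ ‖aₖ‖ ≤ Re ⟨ψ, X ψ⟩` (Wang et al. eq. (obsopt));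
  `…_of_eigenvector_of_energy_le`: the same in every `S^z`-eigen energy eigenstate with `E ≤ u`;
* `exists_unit_joint_groundState_re_dotProduct_ge_…`: such a `ψ` exists (`N ≤ 2|Λ|`);
* `re_dotProduct_ge_of_sector_certificate_ineq_of_unique`: if the `N`-particle ground state is
  unique up to scalars (e.g. Lieb 1989 at half filling, `LiebHalfFilled.groundState_unique`),
  the bound holds for EVERY unit `N`-particle ground vector;
* `hubbardTorus_groundState_re_dotProduct_ge_of_sector_certificate_ineq`: the half-filled even
  square torus `(ℤ/Lℤ)²`, `t ≠ 0`, `U > 0`, where uniqueness is a tree theorem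
  (`LiebHalfFilled.hubbardTorus_exists_unit_groundState`): the bound for every ground vector.

With `X = λ·V` (`V` = double occupancy, a spin or density correlator, the kinetic energy) and
`c − Σ‖a‖ = E_cert` this reads "`λ ⟨V⟩_ψ ≥ E_cert` in the ground state". Everything is PROVED;
no definition, no named fact.

## References
* J. Wang et al., *Certifying ground-state properties of many-body systems*, Phys. Rev. X 14
  (2024) 031006 = arXiv:2310.05844, §3 eq. (obsopt) (energy window as a constraint; finite
  clusters with periodic boundary conditions, App. B). [cite: WangEtAl2024, §3 eq. (obsopt)]
* X. Han, *Quantum many-body bootstrap*, arXiv:2006.06002 (2020), §2 eq. (2)–(3) (conserved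
  charges: charged monomials have zero expectation). [cite: Han2020Bootstrap, §2]
* I. Kull, N. Schuch, B. Dive, M. Navascués, PRX 14 (2024) 021008, §5.3 (rounded certificates,
  residual bound). [cite: KullEtAl2024, §5.3]
* E. H. Lieb, *Two theorems on the Hubbard model*, PRL 62 (1989) 1201 (fixed `S^z` subspaces;
  uniqueness at half filling). [cite: LiebPRL1989]
-/

noncomputable section

open Matrix Finset
open scoped ComplexOrder BigOperators
open Literature.MathematicalPhysics.QuantumManyBody.StateRelaxation

namespace Literature.MathematicalPhysics.QuantumLattice

variable {Λ : Type*} [LinearOrder Λ] [Fintype Λ]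

section SectorCorrelator

variable (G : SimpleGraph Λ) [DecidableRel G.Adj]

/-- **Energy-constrained sector certificate, eigenvector form (any stationary state).** For every
unit `N`-particle vector `ψ` that is an `S^z`-eigenvector and an eigenvector of `H` with ANY
eigenvalue `E` (not only a ground vector), an identity
`X − c·1 − κ (u·1 − H) = Σ Λᵢⱼ Oᵢᴴ Oⱼ + ((Σₖ (H Xₖ − Xₖ H) + Σₗ (Yₗ (N̂ − N) + (N̂ − N) Y'ₗ)) + Σⱼ bⱼ wⱼ)
  + (Σₘ dₘ (Vₘᴴ − Vₘ) + Σₖ aₖ vₖ)` with `Λ ⪰ 0`, charged ladder words `wⱼ`, real `dₘ` and ladder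
words `vₖ` yields `c − Σₖ ‖aₖ‖ + κ (u − E) ≤ Re ⟨ψ, X ψ⟩`: the commutator rows vanish in EVERY
energy eigenstate (Han 2020 "`⟨[H,O]⟩ = 0`"), the sector ideal and the charged words vanish, the
anti-Hermitian parts have zero real part, each residual word costs at most `‖aₖ‖`, and
`⟨ψ, (u·1 − H) ψ⟩ = u − E`. This is the feasibility statement behind Wang et al. 2024 §3
eq. (obsopt) ("the constraints are satisfied by every eigenstate of `H`") in certificate (dual) form.
[cite: WangEtAl2024, §3 eq. (obsopt)] [cite: Han2020Bootstrap, §2] -/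
theorem re_dotProduct_ge_of_sector_certificate_ineq_of_eigenvector (t U : ℝ) {N : ℕ}
    {ψ : Fock (Orb Λ)} (hψN : IsNParticle N ψ) (hψ1 : star ψ ⬝ᵥ ψ = 1)
    {E : ℝ} (hHψ : hamiltonian G t U *ᵥ ψ = (E : ℂ) • ψ)
    {q : ℝ} (hSψ : HubbardWave0.spinZ *ᵥ ψ = (q : ℂ) • ψ)
    (X : Matrix (Finset (Orb Λ)) (Finset (Orb Λ)) ℂ) (κ u : ℝ)
    {m : Type*} [Fintype m] [DecidableEq m] {Λm : Matrix m m ℂ} (hΛ : Λm.PosSemidef)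
    (O : m → Matrix (Finset (Orb Λ)) (Finset (Orb Λ)) ℂ)
    {κ₁ : Type*} (s : Finset κ₁) (Xc : κ₁ → Matrix (Finset (Orb Λ)) (Finset (Orb Λ)) ℂ)
    {κ₂ : Type*} (s' : Finset κ₂) (Y Y' : κ₂ → Matrix (Finset (Orb Λ)) (Finset (Orb Λ)) ℂ)
    {ρ : Type*} (uc : Finset ρ) (b : ρ → ℂ) (cw : ρ → List (Orb Λ × Bool))
    (hcw : ∀ j ∈ uc, ladderCharge (cw j) ≠ 0 ∨ ladderSpinCharge (cw j) ≠ 0)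
    {δ : Type*} (ah : Finset δ) (dc : δ → ℝ) (V : δ → Matrix (Finset (Orb Λ)) (Finset (Orb Λ)) ℂ)
    {κ₃ : Type*} (w : Finset κ₃) (a : κ₃ → ℂ) (word : κ₃ → List (Orb Λ × Bool)) {c : ℝ}
    (hcert : X - (c : ℂ) • (1 : Matrix (Finset (Orb Λ)) (Finset (Orb Λ)) ℂ) -
        ((κ : ℝ) : ℂ) • (((u : ℝ) : ℂ) • (1 : Matrix (Finset (Orb Λ)) (Finset (Orb Λ)) ℂ) -
          hamiltonian G t U) =
      gramForm Λm O +
        ((∑ k ∈ s, (hamiltonian G t U * Xc k - Xc k * hamiltonian G t U) +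
          ∑ l ∈ s', (Y l * (totalNumberOp - (N : ℂ) • 1) + (totalNumberOp - (N : ℂ) • 1) * Y' l)) +
          ∑ j ∈ uc, b j • ladderWord (cw j)) +
        (∑ m' ∈ ah, ((dc m' : ℝ) : ℂ) • ((V m')ᴴ - V m') + ∑ k ∈ w, a k • ladderWord (word k))) :
    c - ∑ k ∈ w, ‖a k‖ + κ * (u - E) ≤ (star ψ ⬝ᵥ X *ᵥ ψ).re := by
  set ω := vectorState ψ with hω
  have hpos : ∀ x : Matrix (Finset (Orb Λ)) (Finset (Orb Λ)) ℂ, 0 ≤ ω (star x * x) :=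
    fun x => vectorState_nonneg ψ x
  have hone : ω 1 = 1 := by rw [hω, vectorState_apply, one_mulVec, hψ1]
  have hHh := LiebThm1.hamiltonian_isHermitian G t U
  -- the objective with the energy constraint folded in
  set X' := X - ((κ : ℝ) : ℂ) • (((u : ℝ) : ℂ) • (1 : Matrix (Finset (Orb Λ)) (Finset (Orb Λ)) ℂ) -
    hamiltonian G t U) with hX'
  have hcert' : X' - (c : ℂ) • (1 : Matrix (Finset (Orb Λ)) (Finset (Orb Λ)) ℂ) =
      gramForm Λm O +
        ((∑ k ∈ s, (hamiltonian G t U * Xc k - Xc k * hamiltonian G t U) +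
          ∑ l ∈ s', (Y l * (totalNumberOp - (N : ℂ) • 1) + (totalNumberOp - (N : ℂ) • 1) * Y' l)) +
          ∑ j ∈ uc, b j • ladderWord (cw j)) +
        (∑ m' ∈ ah, ((dc m' : ℝ) : ℂ) • ((V m')ᴴ - V m') + ∑ k ∈ w, a k • ladderWord (word k)) := by
    rw [hX', sub_right_comm]
    exact hcert
  have hnull : ω ((∑ k ∈ s, (hamiltonian G t U * Xc k - Xc k * hamiltonian G t U) +
      ∑ l ∈ s', (Y l * (totalNumberOp - (N : ℂ) • 1) + (totalNumberOp - (N : ℂ) • 1) * Y' l)) +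
      ∑ j ∈ uc, b j • ladderWord (cw j)) = 0 := by
    rw [map_add, map_add, map_sum, map_sum, map_sum]
    have h1 : ∀ k ∈ s, ω (hamiltonian G t U * Xc k - Xc k * hamiltonian G t U) = 0 :=
      fun k _ => vectorState_commutator hHh hHψ _
    have h2 : ∀ l ∈ s',
        ω (Y l * (totalNumberOp - (N : ℂ) • 1) + (totalNumberOp - (N : ℂ) • 1) * Y' l) = 0 :=
      fun l _ => by
        have hZ : (totalNumberOp - (N : ℂ) • (1 : Matrix (Finset (Orb Λ)) (Finset (Orb Λ)) ℂ)) *ᵥ ψ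
            = 0 := totalNumberOp_sub_mulVec_of_isNParticle N hψN
        have hZ' : (totalNumberOp - (N : ℂ) • (1 : Matrix (Finset (Orb Λ)) (Finset (Orb Λ)) ℂ))ᴴ *ᵥ ψ
            = 0 := by rw [conjTranspose_totalNumberOp_sub]; exact hZ
        have e1 : vectorState ψ (Y l * (totalNumberOp - (N : ℂ) •
            (1 : Matrix (Finset (Orb Λ)) (Finset (Orb Λ)) ℂ))) = 0 :=
          vectorState_mul_of_mulVec_eq_zero ψ (Y l) hZ
        have e2 : vectorState ψ ((totalNumberOp - (N : ℂ) •
            (1 : Matrix (Finset (Orb Λ)) (Finset (Orb Λ)) ℂ)) * Y' l) = 0 :=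
          vectorState_mul_of_conjTranspose_mulVec_eq_zero ψ (Y' l) hZ'
        rw [map_add, hω, e1, e2, add_zero]
    have h3 : ∀ j ∈ uc, ω (b j • ladderWord (cw j)) = 0 := fun j hj => by
      rw [map_smul, hω, vectorState_apply, smul_eq_mul]
      rcases hcw j hj with hq | hq
      · rw [star_dotProduct_ladderWord_mulVec_eq_zero hψN (cw j) hq, mul_zero]
      · rw [star_dotProduct_ladderWord_mulVec_eq_zero_of_spinCharge hSψ (cw j) hq, mul_zero]
    rw [Finset.sum_eq_zero h1, Finset.sum_eq_zero h2, Finset.sum_eq_zero h3, add_zero, add_zero]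
  have hres : -(∑ k ∈ w, ‖a k‖) ≤
      (ω (∑ m' ∈ ah, ((dc m' : ℝ) : ℂ) • ((V m')ᴴ - V m') + ∑ k ∈ w, a k • ladderWord (word k))).re := by
    have hah : (ω (∑ m' ∈ ah, ((dc m' : ℝ) : ℂ) • ((V m')ᴴ - V m'))).re = 0 := by
      rw [map_sum, Complex.re_sum]
      refine Finset.sum_eq_zero fun m' _ => ?_
      -- (the tree has two definitionally equal `vectorState`s; go through the `StateRelaxation` one)
      have hV : (ω ((V m')ᴴ - V m')).re = 0 := vectorState_re_conjTranspose_sub ψ (V m')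
      rw [map_smul, smul_eq_mul, Complex.mul_re, Complex.ofReal_re, Complex.ofReal_im, zero_mul,
        sub_zero, hV, mul_zero]
    have hr : -(∑ k ∈ w, ‖a k‖) ≤ (ω (∑ k ∈ w, a k • ladderWord (word k))).re :=
      neg_sum_norm_le_re_map_sum w ω a (fun k => ladderWord (word k)) fun k _ => by
        have h := (isContraction_prod_ladder (word k)).neg_norm_mul_le (a k) ψ
        rw [hψ1, Complex.one_re, mul_one] at h
        rw [hω, vectorState_apply, ladderWord_eq_prod]
        exact h
    rw [map_add, Complex.add_re, hah, zero_add]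
    exact hr
  have h := le_re_map_of_certificate_residual ω hpos hone hΛ O hnull hres hcert'
  -- evaluate the folded objective in the eigenvector `ψ`
  have hωH : ω (hamiltonian G t U) = (E : ℂ) := by
    rw [hω, vectorState_apply, hHψ, dotProduct_smul, hψ1, smul_eq_mul, mul_one]
  have hωX' : ω X' = ω X - ((κ : ℝ) : ℂ) * (((u : ℝ) : ℂ) - (E : ℂ)) := by
    rw [hX', map_sub, map_smul, map_sub, map_smul, hone, hωH, smul_eq_mul, smul_eq_mul, mul_one]
  have hre : (ω X').re = (star ψ ⬝ᵥ X *ᵥ ψ).re - κ * (u - E) := by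
    rw [hωX', Complex.sub_re, hω, vectorState_apply]
    have e : ((κ : ℝ) : ℂ) * (((u : ℝ) : ℂ) - (E : ℂ)) =
        ((κ * (u - E) : ℝ) : ℂ) := by push_cast; rfl
    rw [e, Complex.ofReal_re]
  rw [hre] at h
  linarith

/-- **Eigenvector form with the energy hypothesis**: if moreover `0 ≤ κ` and `E ≤ u`, then
`c − Σₖ ‖aₖ‖ ≤ Re ⟨ψ, X ψ⟩` — the certified correlator bound holds in every `S^z`-eigen energy
eigenstate of the `N`-sector whose energy does not exceed the hypothesis constant `u` (e.g. every
ground vector when `groundEnergyAt ≤ u`, `re_dotProduct_ge_of_sector_certificate_ineq_of_energy_le`).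
[cite: WangEtAl2024, §3 eq. (obsopt)] -/
theorem re_dotProduct_ge_of_sector_certificate_ineq_of_eigenvector_of_energy_le (t U : ℝ)
    {N : ℕ}
    {ψ : Fock (Orb Λ)} (hψN : IsNParticle N ψ) (hψ1 : star ψ ⬝ᵥ ψ = 1)
    {E : ℝ} (hHψ : hamiltonian G t U *ᵥ ψ = (E : ℂ) • ψ)
    {q : ℝ} (hSψ : HubbardWave0.spinZ *ᵥ ψ = (q : ℂ) • ψ)
    (X : Matrix (Finset (Orb Λ)) (Finset (Orb Λ)) ℂ) {κ u : ℝ} (hκ : 0 ≤ κ)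
    (hu : E ≤ u)
    {m : Type*} [Fintype m] [DecidableEq m] {Λm : Matrix m m ℂ} (hΛ : Λm.PosSemidef)
    (O : m → Matrix (Finset (Orb Λ)) (Finset (Orb Λ)) ℂ)
    {κ₁ : Type*} (s : Finset κ₁) (Xc : κ₁ → Matrix (Finset (Orb Λ)) (Finset (Orb Λ)) ℂ)
    {κ₂ : Type*} (s' : Finset κ₂) (Y Y' : κ₂ → Matrix (Finset (Orb Λ)) (Finset (Orb Λ)) ℂ)
    {ρ : Type*} (uc : Finset ρ) (b : ρ → ℂ) (cw : ρ → List (Orb Λ × Bool))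
    (hcw : ∀ j ∈ uc, ladderCharge (cw j) ≠ 0 ∨ ladderSpinCharge (cw j) ≠ 0)
    {δ : Type*} (ah : Finset δ) (dc : δ → ℝ) (V : δ → Matrix (Finset (Orb Λ)) (Finset (Orb Λ)) ℂ)
    {κ₃ : Type*} (w : Finset κ₃) (a : κ₃ → ℂ) (word : κ₃ → List (Orb Λ × Bool)) {c : ℝ}
    (hcert : X - (c : ℂ) • (1 : Matrix (Finset (Orb Λ)) (Finset (Orb Λ)) ℂ) -
        ((κ : ℝ) : ℂ) • (((u : ℝ) : ℂ) • (1 : Matrix (Finset (Orb Λ)) (Finset (Orb Λ)) ℂ) -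
          hamiltonian G t U) =
      gramForm Λm O +
        ((∑ k ∈ s, (hamiltonian G t U * Xc k - Xc k * hamiltonian G t U) +
          ∑ l ∈ s', (Y l * (totalNumberOp - (N : ℂ) • 1) + (totalNumberOp - (N : ℂ) • 1) * Y' l)) +
          ∑ j ∈ uc, b j • ladderWord (cw j)) +
        (∑ m' ∈ ah, ((dc m' : ℝ) : ℂ) • ((V m')ᴴ - V m') + ∑ k ∈ w, a k • ladderWord (word k))) :
    c - ∑ k ∈ w, ‖a k‖ ≤ (star ψ ⬝ᵥ X *ᵥ ψ).re := by
  have h := re_dotProduct_ge_of_sector_certificate_ineq_of_eigenvector G t U hψN hψ1 hHψ hSψ X κ u hΛ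
    O s Xc s' Y Y' uc b cw hcw ah dc V w a word hcert
  have hslack : 0 ≤ κ * (u - E) := mul_nonneg hκ (sub_nonneg.2 hu)
  linarith

/-- **Energy-constrained sector certificate ⇒ bound on a ground-state expectation value
(identity level).** For every unit `N`-particle vector `ψ` with `H ψ = E₀(N) ψ`
(`E₀(N) = groundEnergyAt G t U N`) which is an `S^z`-eigenvector, an identity
`X − c·1 − κ (u·1 − H) = Σ Λᵢⱼ Oᵢᴴ Oⱼ + ((Σₖ (H Xₖ − Xₖ H) + Σₗ (Yₗ (N̂ − N) + (N̂ − N) Y'ₗ)) + Σⱼ bⱼ wⱼ)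
  + (Σₘ dₘ (Vₘᴴ − Vₘ) + Σₖ aₖ vₖ)` with `Λ ⪰ 0`, charged ladder words `wⱼ`, real `dₘ` and ladder
words `vₖ` yields `c − Σₖ ‖aₖ‖ + κ (u − E₀(N)) ≤ Re ⟨ψ, X ψ⟩`: in the vector state of `ψ` the
commutators, the sector ideal and the charged words vanish, the anti-Hermitian parts have zero
real part, each residual word costs at most `‖aₖ‖`, and `⟨ψ, (u·1 − H) ψ⟩ = u − E₀(N)`.
Wang et al. 2024 §3 eq. (obsopt) in certificate (dual) form; Han 2020 §2.
[cite: WangEtAl2024, §3 eq. (obsopt)] -/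
theorem re_dotProduct_ge_of_sector_certificate_ineq (t U : ℝ) {N : ℕ}
    {ψ : Fock (Orb Λ)} (hψN : IsNParticle N ψ) (hψ1 : star ψ ⬝ᵥ ψ = 1)
    (hHψ : hamiltonian G t U *ᵥ ψ = ((groundEnergyAt G t U N : ℝ) : ℂ) • ψ)
    {q : ℝ} (hSψ : HubbardWave0.spinZ *ᵥ ψ = (q : ℂ) • ψ)
    (X : Matrix (Finset (Orb Λ)) (Finset (Orb Λ)) ℂ) (κ u : ℝ)
    {m : Type*} [Fintype m] [DecidableEq m] {Λm : Matrix m m ℂ} (hΛ : Λm.PosSemidef)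
    (O : m → Matrix (Finset (Orb Λ)) (Finset (Orb Λ)) ℂ)
    {κ₁ : Type*} (s : Finset κ₁) (Xc : κ₁ → Matrix (Finset (Orb Λ)) (Finset (Orb Λ)) ℂ)
    {κ₂ : Type*} (s' : Finset κ₂) (Y Y' : κ₂ → Matrix (Finset (Orb Λ)) (Finset (Orb Λ)) ℂ)
    {ρ : Type*} (uc : Finset ρ) (b : ρ → ℂ) (cw : ρ → List (Orb Λ × Bool))
    (hcw : ∀ j ∈ uc, ladderCharge (cw j) ≠ 0 ∨ ladderSpinCharge (cw j) ≠ 0)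
    {δ : Type*} (ah : Finset δ) (dc : δ → ℝ) (V : δ → Matrix (Finset (Orb Λ)) (Finset (Orb Λ)) ℂ)
    {κ₃ : Type*} (w : Finset κ₃) (a : κ₃ → ℂ) (word : κ₃ → List (Orb Λ × Bool)) {c : ℝ}
    (hcert : X - (c : ℂ) • (1 : Matrix (Finset (Orb Λ)) (Finset (Orb Λ)) ℂ) -
        ((κ : ℝ) : ℂ) • (((u : ℝ) : ℂ) • (1 : Matrix (Finset (Orb Λ)) (Finset (Orb Λ)) ℂ) -
          hamiltonian G t U) =
      gramForm Λm O +
        ((∑ k ∈ s, (hamiltonian G t U * Xc k - Xc k * hamiltonian G t U) +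
          ∑ l ∈ s', (Y l * (totalNumberOp - (N : ℂ) • 1) + (totalNumberOp - (N : ℂ) • 1) * Y' l)) +
          ∑ j ∈ uc, b j • ladderWord (cw j)) +
        (∑ m' ∈ ah, ((dc m' : ℝ) : ℂ) • ((V m')ᴴ - V m') + ∑ k ∈ w, a k • ladderWord (word k))) :
    c - ∑ k ∈ w, ‖a k‖ + κ * (u - groundEnergyAt G t U N) ≤ (star ψ ⬝ᵥ X *ᵥ ψ).re :=
  re_dotProduct_ge_of_sector_certificate_ineq_of_eigenvector G t U hψN hψ1 hHψ hSψ X κ u hΛ O s Xc s'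
    Y Y' uc b cw hcw ah dc V w a word hcert

/-- **With the energy hypothesis** (Wang et al. 2024 §3 eq. (obsopt): the ground state is feasible
for the constraint `⟨E_up − H⟩ ≥ 0`): under the hypotheses of
`re_dotProduct_ge_of_sector_certificate_ineq`, if `0 ≤ κ` and `groundEnergyAt G t U N ≤ u`
(a certified upper bound on the sector ground energy), then `c − Σₖ ‖aₖ‖ ≤ Re ⟨ψ, X ψ⟩`.
[cite: WangEtAl2024, §3 eq. (obsopt)] -/
theorem re_dotProduct_ge_of_sector_certificate_ineq_of_energy_le (t U : ℝ) {N : ℕ}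
    {ψ : Fock (Orb Λ)} (hψN : IsNParticle N ψ) (hψ1 : star ψ ⬝ᵥ ψ = 1)
    (hHψ : hamiltonian G t U *ᵥ ψ = ((groundEnergyAt G t U N : ℝ) : ℂ) • ψ)
    {q : ℝ} (hSψ : HubbardWave0.spinZ *ᵥ ψ = (q : ℂ) • ψ)
    (X : Matrix (Finset (Orb Λ)) (Finset (Orb Λ)) ℂ) {κ u : ℝ} (hκ : 0 ≤ κ)
    (hu : groundEnergyAt G t U N ≤ u)
    {m : Type*} [Fintype m] [DecidableEq m] {Λm : Matrix m m ℂ} (hΛ : Λm.PosSemidef)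
    (O : m → Matrix (Finset (Orb Λ)) (Finset (Orb Λ)) ℂ)
    {κ₁ : Type*} (s : Finset κ₁) (Xc : κ₁ → Matrix (Finset (Orb Λ)) (Finset (Orb Λ)) ℂ)
    {κ₂ : Type*} (s' : Finset κ₂) (Y Y' : κ₂ → Matrix (Finset (Orb Λ)) (Finset (Orb Λ)) ℂ)
    {ρ : Type*} (uc : Finset ρ) (b : ρ → ℂ) (cw : ρ → List (Orb Λ × Bool))
    (hcw : ∀ j ∈ uc, ladderCharge (cw j) ≠ 0 ∨ ladderSpinCharge (cw j) ≠ 0)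
    {δ : Type*} (ah : Finset δ) (dc : δ → ℝ) (V : δ → Matrix (Finset (Orb Λ)) (Finset (Orb Λ)) ℂ)
    {κ₃ : Type*} (w : Finset κ₃) (a : κ₃ → ℂ) (word : κ₃ → List (Orb Λ × Bool)) {c : ℝ}
    (hcert : X - (c : ℂ) • (1 : Matrix (Finset (Orb Λ)) (Finset (Orb Λ)) ℂ) -
        ((κ : ℝ) : ℂ) • (((u : ℝ) : ℂ) • (1 : Matrix (Finset (Orb Λ)) (Finset (Orb Λ)) ℂ) -
          hamiltonian G t U) =
      gramForm Λm O +
        ((∑ k ∈ s, (hamiltonian G t U * Xc k - Xc k * hamiltonian G t U) +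
          ∑ l ∈ s', (Y l * (totalNumberOp - (N : ℂ) • 1) + (totalNumberOp - (N : ℂ) • 1) * Y' l)) +
          ∑ j ∈ uc, b j • ladderWord (cw j)) +
        (∑ m' ∈ ah, ((dc m' : ℝ) : ℂ) • ((V m')ᴴ - V m') + ∑ k ∈ w, a k • ladderWord (word k))) :
    c - ∑ k ∈ w, ‖a k‖ ≤ (star ψ ⬝ᵥ X *ᵥ ψ).re := by
  have h := re_dotProduct_ge_of_sector_certificate_ineq G t U hψN hψ1 hHψ hSψ X κ u hΛ O s Xc s'
    Y Y' uc b cw hcw ah dc V w a word hcert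
  have hslack : 0 ≤ κ * (u - groundEnergyAt G t U N) := mul_nonneg hκ (sub_nonneg.2 hu)
  linarith

/-- **Existence form.** For `N ≤ 2|Λ|` there is a unit `N`-particle ground vector `ψ` that is an
`S^z`-eigenvector (`exists_unit_joint_groundState`), and for it the certificate bound holds:
`∃ ψ, … ∧ c − Σₖ ‖aₖ‖ ≤ Re ⟨ψ, X ψ⟩`. This is the statement a sector-mode certificate makes when
the ground state is degenerate and no symmetric state is singled out. Lieb 1989 (work at fixed
`S^z`). [cite: LiebPRL1989] -/
theorem exists_unit_joint_groundState_re_dotProduct_ge_of_sector_certificate_ineq (t U : ℝ) {N : ℕ}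
    (hN : N ≤ 2 * Fintype.card Λ)
    (X : Matrix (Finset (Orb Λ)) (Finset (Orb Λ)) ℂ) {κ u : ℝ} (hκ : 0 ≤ κ)
    (hu : groundEnergyAt G t U N ≤ u)
    {m : Type*} [Fintype m] [DecidableEq m] {Λm : Matrix m m ℂ} (hΛ : Λm.PosSemidef)
    (O : m → Matrix (Finset (Orb Λ)) (Finset (Orb Λ)) ℂ)
    {κ₁ : Type*} (s : Finset κ₁) (Xc : κ₁ → Matrix (Finset (Orb Λ)) (Finset (Orb Λ)) ℂ)
    {κ₂ : Type*} (s' : Finset κ₂) (Y Y' : κ₂ → Matrix (Finset (Orb Λ)) (Finset (Orb Λ)) ℂ)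
    {ρ : Type*} (uc : Finset ρ) (b : ρ → ℂ) (cw : ρ → List (Orb Λ × Bool))
    (hcw : ∀ j ∈ uc, ladderCharge (cw j) ≠ 0 ∨ ladderSpinCharge (cw j) ≠ 0)
    {δ : Type*} (ah : Finset δ) (dc : δ → ℝ) (V : δ → Matrix (Finset (Orb Λ)) (Finset (Orb Λ)) ℂ)
    {κ₃ : Type*} (w : Finset κ₃) (a : κ₃ → ℂ) (word : κ₃ → List (Orb Λ × Bool)) {c : ℝ}
    (hcert : X - (c : ℂ) • (1 : Matrix (Finset (Orb Λ)) (Finset (Orb Λ)) ℂ) -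
        ((κ : ℝ) : ℂ) • (((u : ℝ) : ℂ) • (1 : Matrix (Finset (Orb Λ)) (Finset (Orb Λ)) ℂ) -
          hamiltonian G t U) =
      gramForm Λm O +
        ((∑ k ∈ s, (hamiltonian G t U * Xc k - Xc k * hamiltonian G t U) +
          ∑ l ∈ s', (Y l * (totalNumberOp - (N : ℂ) • 1) + (totalNumberOp - (N : ℂ) • 1) * Y' l)) +
          ∑ j ∈ uc, b j • ladderWord (cw j)) +
        (∑ m' ∈ ah, ((dc m' : ℝ) : ℂ) • ((V m')ᴴ - V m') + ∑ k ∈ w, a k • ladderWord (word k))) :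
    ∃ ψ : Fock (Orb Λ), IsNParticle N ψ ∧ star ψ ⬝ᵥ ψ = 1 ∧
      hamiltonian G t U *ᵥ ψ = ((groundEnergyAt G t U N : ℝ) : ℂ) • ψ ∧
      c - ∑ k ∈ w, ‖a k‖ ≤ (star ψ ⬝ᵥ X *ᵥ ψ).re := by
  obtain ⟨ψ, hψN, hψ1, hHψ, q, hSψ⟩ := exists_unit_joint_groundState G t U hN
  exact ⟨ψ, hψN, hψ1, hHψ, re_dotProduct_ge_of_sector_certificate_ineq_of_energy_le G t U hψN hψ1
    hHψ hSψ X hκ hu hΛ O s Xc s' Y Y' uc b cw hcw ah dc V w a word hcert⟩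

/-- **Unique ground state ⇒ the bound holds for every ground vector.** If every `N`-particle
ground vector is a multiple of a fixed one (`huniq`; e.g. Lieb 1989 Thm 2 at half filling on a
connected bipartite graph with `|A| = |B|`, `LiebHalfFilled.groundState_unique`), then every unit
`N`-particle ground vector `ψ` is automatically an `S^z`-eigenvector (`S^z` commutes with `H` and
preserves the sector, so `S^z ψ` is again a ground vector), and the certificate bound
`c − Σₖ ‖aₖ‖ ≤ Re ⟨ψ, X ψ⟩` holds for it. Wang et al. 2024 §3; Lieb 1989.
[cite: WangEtAl2024, §3 eq. (obsopt)] -/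
theorem re_dotProduct_ge_of_sector_certificate_ineq_of_unique (t U : ℝ) {N : ℕ}
    {φ : Fock (Orb Λ)}
    (huniq : ∀ ξ : Fock (Orb Λ), IsNParticle N ξ →
      hamiltonian G t U *ᵥ ξ = ((groundEnergyAt G t U N : ℝ) : ℂ) • ξ → ∃ z : ℂ, ξ = z • φ)
    {ψ : Fock (Orb Λ)} (hψN : IsNParticle N ψ) (hψ1 : star ψ ⬝ᵥ ψ = 1)
    (hHψ : hamiltonian G t U *ᵥ ψ = ((groundEnergyAt G t U N : ℝ) : ℂ) • ψ)
    (X : Matrix (Finset (Orb Λ)) (Finset (Orb Λ)) ℂ) {κ u : ℝ} (hκ : 0 ≤ κ)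
    (hu : groundEnergyAt G t U N ≤ u)
    {m : Type*} [Fintype m] [DecidableEq m] {Λm : Matrix m m ℂ} (hΛ : Λm.PosSemidef)
    (O : m → Matrix (Finset (Orb Λ)) (Finset (Orb Λ)) ℂ)
    {κ₁ : Type*} (s : Finset κ₁) (Xc : κ₁ → Matrix (Finset (Orb Λ)) (Finset (Orb Λ)) ℂ)
    {κ₂ : Type*} (s' : Finset κ₂) (Y Y' : κ₂ → Matrix (Finset (Orb Λ)) (Finset (Orb Λ)) ℂ)
    {ρ : Type*} (uc : Finset ρ) (b : ρ → ℂ) (cw : ρ → List (Orb Λ × Bool))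
    (hcw : ∀ j ∈ uc, ladderCharge (cw j) ≠ 0 ∨ ladderSpinCharge (cw j) ≠ 0)
    {δ : Type*} (ah : Finset δ) (dc : δ → ℝ) (V : δ → Matrix (Finset (Orb Λ)) (Finset (Orb Λ)) ℂ)
    {κ₃ : Type*} (w : Finset κ₃) (a : κ₃ → ℂ) (word : κ₃ → List (Orb Λ × Bool)) {c : ℝ}
    (hcert : X - (c : ℂ) • (1 : Matrix (Finset (Orb Λ)) (Finset (Orb Λ)) ℂ) -
        ((κ : ℝ) : ℂ) • (((u : ℝ) : ℂ) • (1 : Matrix (Finset (Orb Λ)) (Finset (Orb Λ)) ℂ) -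
          hamiltonian G t U) =
      gramForm Λm O +
        ((∑ k ∈ s, (hamiltonian G t U * Xc k - Xc k * hamiltonian G t U) +
          ∑ l ∈ s', (Y l * (totalNumberOp - (N : ℂ) • 1) + (totalNumberOp - (N : ℂ) • 1) * Y' l)) +
          ∑ j ∈ uc, b j • ladderWord (cw j)) +
        (∑ m' ∈ ah, ((dc m' : ℝ) : ℂ) • ((V m')ᴴ - V m') + ∑ k ∈ w, a k • ladderWord (word k))) :
    c - ∑ k ∈ w, ‖a k‖ ≤ (star ψ ⬝ᵥ X *ᵥ ψ).re := by
  -- `S^z ψ` is again an `N`-particle ground vector, hence a multiple of `φ`, hence of `ψ`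
  have hψ0 : ψ ≠ 0 := by
    rintro rfl
    simp at hψ1
  obtain ⟨z, hz⟩ := huniq ψ hψN hHψ
  have hz0 : z ≠ 0 := by
    rintro rfl
    rw [zero_smul] at hz
    exact hψ0 hz
  have hQA : HubbardWave0.spinZ * hamiltonian G t U = hamiltonian G t U * HubbardWave0.spinZ :=
    (hamiltonian_isHermitian_and_commute_holds G t U).2.2.eq.symm
  have hSN : IsNParticle N (HubbardWave0.spinZ *ᵥ ψ) := fun S hS => by
    show (HubbardWave0.spinZ *ᵥ ψ) S = 0
    rw [LiebThm1.spinZ_mulVec_apply, hψN S hS, mul_zero]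
  have hSH : hamiltonian G t U *ᵥ (HubbardWave0.spinZ *ᵥ ψ) =
      ((groundEnergyAt G t U N : ℝ) : ℂ) • (HubbardWave0.spinZ *ᵥ ψ) := by
    rw [mulVec_mulVec, ← hQA, ← mulVec_mulVec, hHψ, mulVec_smul]
  obtain ⟨z', hz'⟩ := huniq _ hSN hSH
  have hSψ' : HubbardWave0.spinZ *ᵥ ψ = (z' * z⁻¹) • ψ := by
    rw [hz', mul_smul, hz, smul_smul z⁻¹, inv_mul_cancel₀ hz0, one_smul]
  obtain ⟨q, hSψ⟩ := Matrix.IsHermitian.exists_real_mulVec_eq_smul HubbardWave0.spinZ_isHermitian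
    hSψ' hψ0
  exact re_dotProduct_ge_of_sector_certificate_ineq_of_energy_le G t U hψN hψ1 hHψ hSψ X hκ hu hΛ O
    s Xc s' Y Y' uc b cw hcw ah dc V w a word hcert

end SectorCorrelator

/-! ### The half-filled even square torus: the bound for THE ground state (Lieb 1989) -/

section Torus

variable {L : ℕ} [NeZero L]

/-- (Local to this section, as in `HubbardCorrelatorCertificate` / `HubbardTorusLocalCertificate`:
pins `DecidableEq (FermionTorus 2 L)` to the `LinearOrder` one so that the `Finset (Orb _)` matrix
types of this file and of `HubbardHalfFilledGroundStateTorus` agree syntactically.) [folklore] -/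
local instance (priority := high) instDecidableEqFermionTorusSectorCorr :
    DecidableEq (FermionTorus 2 L) :=
  LinearOrder.toDecidableEq

/-- **Half-filled even square torus: the sector certificate bounds EVERY ground state.** On
`(ℤ/Lℤ)²` with `L` even, `t ≠ 0`, `U > 0`, the `L²`-particle ground state is unique (Lieb 1989,
Theorem 2; tree `LiebHalfFilled.hubbardTorus_exists_unit_groundState`), so a sector-mode
certificate with an energy hypothesis `E₀(L²) ≤ u`, `κ ≥ 0`, yields `c − Σₖ ‖aₖ‖ ≤ Re ⟨ψ, X ψ⟩`
for every unit `L²`-particle ground vector `ψ`. Wang et al. 2024 §3 eq. (obsopt); Lieb 1989.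
[cite: WangEtAl2024, §3 eq. (obsopt)] -/
theorem hubbardTorus_groundState_re_dotProduct_ge_of_sector_certificate_ineq (hL : Even L)
    {t U : ℝ} (ht : t ≠ 0) (hU : 0 < U)
    {ψ : Fock (Orb (FermionTorus 2 L))} (hψN : IsNParticle (L ^ 2) ψ) (hψ1 : star ψ ⬝ᵥ ψ = 1)
    (hHψ : hamiltonian (fermionTorusGraph 2 L) t U *ᵥ ψ =
      ((groundEnergyAt (fermionTorusGraph 2 L) t U (L ^ 2) : ℝ) : ℂ) • ψ)
    (X : Matrix (Finset (Orb (FermionTorus 2 L))) (Finset (Orb (FermionTorus 2 L))) ℂ)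
    {κ u : ℝ} (hκ : 0 ≤ κ) (hu : groundEnergyAt (fermionTorusGraph 2 L) t U (L ^ 2) ≤ u)
    {m : Type*} [Fintype m] [DecidableEq m] {Λm : Matrix m m ℂ} (hΛ : Λm.PosSemidef)
    (O : m → Matrix (Finset (Orb (FermionTorus 2 L))) (Finset (Orb (FermionTorus 2 L))) ℂ)
    {κ₁ : Type*} (s : Finset κ₁)
    (Xc : κ₁ → Matrix (Finset (Orb (FermionTorus 2 L))) (Finset (Orb (FermionTorus 2 L))) ℂ)
    {κ₂ : Type*} (s' : Finset κ₂)
    (Y Y' : κ₂ → Matrix (Finset (Orb (FermionTorus 2 L))) (Finset (Orb (FermionTorus 2 L))) ℂ)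
    {ρ : Type*} (uc : Finset ρ) (b : ρ → ℂ) (cw : ρ → List (Orb (FermionTorus 2 L) × Bool))
    (hcw : ∀ j ∈ uc, ladderCharge (cw j) ≠ 0 ∨ ladderSpinCharge (cw j) ≠ 0)
    {δ : Type*} (ah : Finset δ) (dc : δ → ℝ)
    (V : δ → Matrix (Finset (Orb (FermionTorus 2 L))) (Finset (Orb (FermionTorus 2 L))) ℂ)
    {κ₃ : Type*} (w : Finset κ₃) (a : κ₃ → ℂ) (word : κ₃ → List (Orb (FermionTorus 2 L) × Bool))
    {c : ℝ}
    (hcert : X - (c : ℂ) • (1 : Matrix (Finset (Orb (FermionTorus 2 L))) (Finset (Orb (FermionTorus 2 L))) ℂ) -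
        ((κ : ℝ) : ℂ) • (((u : ℝ) : ℂ) •
          (1 : Matrix (Finset (Orb (FermionTorus 2 L))) (Finset (Orb (FermionTorus 2 L))) ℂ) -
          hamiltonian (fermionTorusGraph 2 L) t U) =
      gramForm Λm O +
        ((∑ k ∈ s, (hamiltonian (fermionTorusGraph 2 L) t U * Xc k -
            Xc k * hamiltonian (fermionTorusGraph 2 L) t U) +
          ∑ l ∈ s', (Y l * (totalNumberOp - ((L ^ 2 : ℕ) : ℂ) • 1) +
            (totalNumberOp - ((L ^ 2 : ℕ) : ℂ) • 1) * Y' l)) +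
          ∑ j ∈ uc, b j • ladderWord (cw j)) +
        (∑ m' ∈ ah, ((dc m' : ℝ) : ℂ) • ((V m')ᴴ - V m') + ∑ k ∈ w, a k • ladderWord (word k))) :
    c - ∑ k ∈ w, ‖a k‖ ≤ (star ψ ⬝ᵥ X *ᵥ ψ).re := by
  obtain ⟨φ, -, -, -, -, huniq, -⟩ := LiebHalfFilled.hubbardTorus_exists_unit_groundState (L := L) hL ht hU
  exact re_dotProduct_ge_of_sector_certificate_ineq_of_unique (fermionTorusGraph 2 L) t U
    (fun ξ hξ hHξ => ⟨star φ ⬝ᵥ ξ, huniq ξ hξ hHξ⟩) hψN hψ1 hHψ X hκ hu hΛ O s Xc s' Y Y' uc b cw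
    hcw ah dc V w a word hcert

end Torus

end Literature.MathematicalPhysics.QuantumLattice
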